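import Summits.BirchSwinnertonDyer.BirchSwinnertonDyer.Theses.PrintX8VSC
import Summits.BirchSwinnertonDyer.Rank1Residual.Supersingular.SharpFlatNonvanishing
import Literature.NumberTheory.EllipticCurves.Sprung2012.SharpFlatSelmerDualExistsProofs
import Literature.NumberTheory.EllipticCurves.Sprung2012.SharpFlatSelmerDualInvolutionTwistProofs
import Literature.NumberTheory.EllipticCurves.SkinnerUrban2014.CharacteristicIdealBaseChangeProofs
import Literature.NumberTheory.EllipticCurves.IwasawaAlgebraRankOneIdealProofs
import Literature.NumberTheory.EllipticCurves.IwasawaEulerCharProofs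
import Literature.NumberTheory.EllipticCurves.CyclotomicIwasawaMainTheoremIrreducibleProofs
import HarnessLib

/-!
# Route `PrintX8VSC`: BOTH residual cruxes K′ (`KatoFineLowerSporadicGivenHeldX8Contra`, item 23732) and
# C′ (`CyclotomicLowerPosLevelGivenHeldX8Contra`, item 23733) FOLLOW, BY NAME, from the ONE printed-open
# statement the cell's BSTW verdict names as the exact missing input — Sprung's ♯/♭ Main Conjecture 7.21 in
# PRINT keying on class X8 (good supersingular `3`, `a₃ = ±3`), all analytic ranks

Cell `bsd-print-x8`, prover seat p3 (gen 7), strategy sentence «does BSTW 2024 cover `a_p ≠ 0` at `p = 3`?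
read §1 hypotheses AT THE PAGE: … no ⇒ the exact missing input is the crux». The verdict is NO (P3-VERDICT,
2026-08-27; BSTW arXiv:2409.01350v2 (1.7)/Thm 10.1 assume `a_p = 0`; at `(3, ±3)` BSTW print only Kato's
divisibility, Thm 9.21 (a)(b)). This file is the KERNEL form of the «no» branch: the exact missing input — the
`a₃ = ±3` twin of BSTW's Thm 10.1, i.e. Sprung 2012 Main Conj. 7.21 for the PRINTED dual `𝒳^•* = X^•(γ⁻¹)`
(what Sprung, Adv. Math. 449 (2024) Thm 1.1 proves for square-free `N` GIVEN his Conj. 3.33 on the two-variable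
♯/♭ Beilinson–Flach element) — implies BOTH research residues of the route, with nothing else:

* §1 (pointwise, any height-one `𝔭`, any pair) `katoFineLengthAt_eq_of_charIdeal_eq_contra`: for a contragredient
  ♯/♭ Coleman–Kato package `C` of a colour `•` with `L^• ≠ 0`, `E[p]` irreducible, and ONE print-keyed dual datum
  `D′` of `Sel^•(E/ℚ_∞)` that is f.g. torsion with `char D′.X = (gen)`, `ι gen = C(ϖ)·ι L^•` (Main Conj. 7.21 for
  that datum): `ℓ_𝔭(𝐇¹ ⧸ C.Z) = ℓ_𝔭 Y′.X` for EVERY print-keyed fine datum `Y′` and EVERY height-one `𝔭` — Kato's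
  Conj. 12.10 read prime by prime (Sprung's Prop. 7.19 «equivalent to Kato», direction MC 7.21 ⟹ 12.10). Proof =
  the four-term identity `SharpFlatColemanKatoDataContra.lengthAt_add_eq` (`ℓ D′ + ℓ(𝐇¹/Z) = ℓ Y′ + ℓ Λ/(gen)`,
  LEAD 19875 g6, `…SqueezeToCommonZerosContra` §1) + «the characteristic ideal determines the height-one lengths»
  (`SkinnerUrban2014.lengthAt_eq_of_charIdeal_eq`, `Module.charIdeal_quotient_span_singleton`) + cancellation in `ℕ∞`.
* §2 (pointwise) `lengthAt_quotient_span_le_of_charIdeal_eq_contra`: `char D′.X = (gen)`, `ι gen = C(ϖ)·ι L^• = ι G`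
  ⟹ `ℓ_𝔭 Λ/(G) ≤ ℓ_𝔭 D′.X` (equality) — pure `Λ`-algebra.
* §3 `katoFineLowerSporadicGivenHeldX8Contra_of_mainConjecture721Contra` /
  `cyclotomicLowerPosLevelGivenHeldX8Contra_of_mainConjecture721Contra`: the two ROUTE DECLS by name from the
  hypothesis `hMC` = the body of `PrintX8VSC.SharpFlatMainConjectureX8Contra` (item 23742) with its binder
  `W.analyticRank ≤ 1 →` DELETED (the cruxes carry no rank binder) = `Theorems.SprungSharpFlatMainConjecture W p •`
  with the dual datum keyed `γ⁻¹` (Sprung 2012 §7.5, `𝒳^•*`), for every X8 pair and every colour with `L^• ≠ 0`.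
  On X8 some colour is non-zero (`Supersingular.ClassX8.exists_chromaticL_ne_zero`, Rohrlich) and the fine /
  sporadic / cyclotomic side conditions of the cruxes are not even used: the printed conjecture gives Kato's
  fine EQUALITY at every height-one prime.
* §4 from the route's OWN item 23742 `SharpFlatMainConjectureX8Contra` (as filed: analytic rank ≤ 1) BY NAME: Kato's
  Conj. 12.10 in length form (`ℓ_𝔭(𝐇¹ ⧸ C.Z) = ℓ_𝔭 Y′.X`) and the C′ inequality, at every height-one prime, on
  X8 ∩ {r_an ≤ 1} — the locus of all 217 census cells (r0 142 + r1 75) — closing the circle with the PROVED glue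
  23743 (K′ ∧ C′ ∧ packs ⟹ 23742).

HONEST FRAMING. Nothing here is progress on BSD: K′, C′, MC′, leaf X8 and BSD are NOT proved, and `hMC` is an OPEN
conjecture displayed as a hypothesis (never a Literature fact). What the file certifies is the cell's reading of
its own residual: together with the PROVED glue `PrintX8VSC.GlueSharpFlatMainConjectureOfKatoSporadicX8Contra`
(item 23743, w2 g11 p676900: K′ ∧ C′ ∧ held packs ⟹ MC′ on X8 ∩ {r_an ≤ 1}) the route's open content is
sandwiched `MC₇.₂₁′(X8) ⟹ K′ ∧ C′ ⟹ [packs] MC₇.₂₁′(X8, r_an ≤ 1)`; so a `stub-false` witness against either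
registered residue stub (`stub_iotaResidueContra` / `stub_iotaResidueCyclotomicContra`) REFUTES the printed main
conjecture at that X8 pair (the route's KILL CRITERIA, now a kernel implication), and any print of Main Conj. 7.21
at `(3, a₃ = ±3)` closes both cruxes in one line each. beyond-print theorem: no (certificate).

References: [Sprung2012] Def. 6.1 (p. 1495), Def. 7.11 (p. 1503), Thm. 7.14 with (3) (p. 1504), Prop. 7.19 and
Main Conj. 7.21 (p. 1505); [Kato2004Asterisque] Conj. 12.10 (p. 224), §17.13 (p. 279–280); [BurungaleSkinnerTianWan2024]
(1.7), Thm. 1.3, Thm. 9.21, Thm. 10.1; [Sprung2024] Thm. 1.1, Conj. 3.33; [SkinnerUrban2014] §3.1.6; [Washington1997] §13.2.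
-/

set_option linter.dupNamespace false
set_option autoImplicit false

noncomputable section

open scoped Classical NumberField MatrixGroups ModularForm

open NumberField IsDedekindDomain CongruenceSubgroup WeierstrassCurve Field
  Literature.NumberTheory.EllipticCurves Literature.NumberTheory.EllipticCurves.ModularForms
  Literature.NumberTheory.EllipticCurves.ZpExtension Literature.NumberTheory.EllipticCurves.Sprung2017
  Literature.NumberTheory.EllipticCurves.Sprung2012 Literature.NumberTheory.EllipticCurves.Rank1Residual
  Literature.NumberTheory.EllipticCurves.IwasawaAlgebra Literature.NumberTheory.EllipticCurves.Kato2004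
  Summit.BirchSwinnertonDyer.BirchSwinnertonDyer.Theorems

namespace Summit.BirchSwinnertonDyer.BirchSwinnertonDyer.Theorems.PrintX8VSCOfMainConjecture721

/-! ### §0 `Λ`-algebra plumbing -/

/-- `Λ ⧸ (x)` is `Λ`-torsion for `x ≠ 0` (killed by `x`). [folklore] -/
theorem isTorsion_quotient_span_singleton {p : ℕ} [Fact p.Prime] {x : IwasawaAlgebra p} (hx : x ≠ 0) :
    Module.IsTorsion (IwasawaAlgebra p) (IwasawaAlgebra p ⧸ Ideal.span {x}) := by
  intro q
  refine ⟨⟨x, mem_nonZeroDivisors_of_ne_zero hx⟩, ?_⟩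
  induction q using Submodule.Quotient.induction_on with
  | H y =>
    rw [Submonoid.smul_def]
    change x • Submodule.Quotient.mk y = 0
    rw [← Submodule.Quotient.mk_smul, Submodule.Quotient.mk_eq_zero, smul_eq_mul]
    exact Ideal.mul_mem_right _ _ (Ideal.mem_span_singleton_self x)

/-- **The characteristic ideal pins the height-one lengths**: a finitely generated torsion `Λ`-module `M` with
`char_Λ M = (x)` has `ℓ_𝔭 M = ℓ_𝔭 Λ/(x)` at every height-one `𝔭` (`x ≠ 0` automatically, `char ≠ ⊥`).
[cite: SkinnerUrban2014, §3.1.6 (p. 20)] [cite: Washington1997, §13.2] -/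
theorem lengthAt_eq_quotient_span_of_charIdeal_eq {p : ℕ} [Fact p.Prime] {M : Type*} [AddCommGroup M]
    [Module (IwasawaAlgebra p) M] [Module.Finite (IwasawaAlgebra p) M]
    (hM : Module.IsTorsion (IwasawaAlgebra p) M) {x : IwasawaAlgebra p}
    (hchar : Module.charIdeal (IwasawaAlgebra p) M = Ideal.span {x})
    (𝔭 : PrimeSpectrum (IwasawaAlgebra p)) (h𝔭 : 𝔭.asIdeal.height = 1) :
    Module.lengthAt (IwasawaAlgebra p) M 𝔭 =
      Module.lengthAt (IwasawaAlgebra p) (IwasawaAlgebra p ⧸ Ideal.span {x}) 𝔭 := by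
  have hx : x ≠ 0 := by
    rintro rfl
    apply Module.charIdeal_ne_bot (IwasawaAlgebra p) M
    rw [hchar, Ideal.span_singleton_eq_bot]
  exact SkinnerUrban2014.lengthAt_eq_of_charIdeal_eq hM (isTorsion_quotient_span_singleton hx)
    (hchar.trans (Module.charIdeal_quotient_span_singleton hx).symm) 𝔭 h𝔭

/-! ### §1 Main Conj. 7.21 (print key) for ONE datum of a non-zero colour ⟹ Kato's Conj. 12.10 at every height-one prime -/

section Package

variable (W : WeierstrassCurve ℚ) [W.IsElliptic] (p : ℕ) [Fact p.Prime]
  [ContinuousSMul ℤ_[p] (W.tateModule p)] [Module.Free ℤ_[p] (W.tateModule p)]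
  [Module.Finite ℤ_[p] (W.tateModule p)]
  {N : ℕ} {f : CuspForm (Gamma0 N) 2} {ϖ : ℚ} {κ : ZpExtension ℚ p} {γ : absoluteGaloisGroup ℚ}
  {E : Type} [Field E] [Algebra ℚ E] {ι : AlgebraicClosure ℚ →ₐ[ℚ] AlgebraicClosure E} {ap : ℤ}
  {g : absoluteGaloisGroup E} {c : ℕ → localPoints W E} {col : Chroma}
  {I : IwasawaH1Data W p κ γ}

/-- **Sprung's Main Conj. 7.21 AS PRINTED, for one dual datum of a colour `•` with `L^• ≠ 0`, gives Kato's Conj.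
12.10 in length form at EVERY height-one prime.** For a contragredient package `C` of colour `•` over Kato's pinned
`𝐇¹` (`E[p]` irreducible, Sprung pair with `L^• ≠ 0`) and a `γ⁻¹`-keyed dual datum `D′` of `Sel^•(E/ℚ_∞)`,
finitely generated torsion with `char D′.X = (gen)`, `ι gen = C(ϖ)·ι L^•`: for every `γ⁻¹`-keyed fine datum `Y′`
and every height-one `𝔭`, `ℓ_𝔭(𝐇¹ ⧸ C.Z) = ℓ_𝔭 Y′.X`. Proof: the four-term identity
`ℓ D′ + ℓ(𝐇¹/Z) = ℓ Y′ + ℓ Λ/(gen)` (`SharpFlatColemanKatoDataContra.lengthAt_add_eq`) and `ℓ D′ = ℓ Λ/(gen)`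
(the characteristic ideal pins the lengths), cancelled in `ℕ∞` (`ℓ D′ ≠ ⊤`). Direction «7.21 ⟹ Kato» of Sprung's
Prop. 7.19. [cite: Sprung2012, Thm. 7.14 (3) (p. 1504), Prop. 7.19 and Main Conj. 7.21 (p. 1505)]
[cite: Kato2004Asterisque, Conj. 12.10 (p. 224), §17.13 (p. 280)] [cite: SkinnerUrban2014, §3.1.6 (p. 20)] -/
theorem katoFineLengthAt_eq_of_charIdeal_eq_contra
    (C : SharpFlatColemanKatoDataContra W p f ϖ κ γ ι ap g c col I)
    (hirr : W.HasIrreducibleModPGaloisRep p) {Lsharp Lflat : IwasawaAlgebra p}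
    (hSP : IsSprungPair f p ap Lsharp Lflat) (hcol : chromaticL col Lsharp Lflat ≠ 0)
    (D : SharpFlatSelmerDualData W κ γ⁻¹ ι ap g c col) [Module.Finite (IwasawaAlgebra p) D.X]
    (hDt : Module.IsTorsion (IwasawaAlgebra p) D.X) {gen : IwasawaAlgebra p}
    (hchar : D.charIdeal = Ideal.span {gen})
    (hgen : iwasawaToPowerSeries p gen =
      PowerSeries.C ((ϖ : ℚ) : ℚ_[p]) * iwasawaToPowerSeries p (chromaticL col Lsharp Lflat))
    (Y : W.FineSelmerDualData κ γ⁻¹) (𝔭 : PrimeSpectrum (IwasawaAlgebra p)) (h𝔭 : 𝔭.asIdeal.height = 1) :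
    Module.lengthAt (IwasawaAlgebra p) (I.H ⧸ C.Z) 𝔭 = Module.lengthAt (IwasawaAlgebra p) Y.X 𝔭 := by
  have hFT := C.lengthAt_add_eq W p hirr hSP hcol hgen D Y 𝔭 h𝔭
  have hD : Module.lengthAt (IwasawaAlgebra p) D.X 𝔭 =
      Module.lengthAt (IwasawaAlgebra p) (IwasawaAlgebra p ⧸ Ideal.span {gen}) 𝔭 :=
    lengthAt_eq_quotient_span_of_charIdeal_eq hDt hchar 𝔭 h𝔭
  have hfin : Module.lengthAt (IwasawaAlgebra p) D.X 𝔭 ≠ ⊤ :=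
    IwasawaAlgebra.lengthAt_ne_top_of_isTorsion D.X hDt 𝔭 h𝔭.le
  rw [← hD, add_comm (Module.lengthAt (IwasawaAlgebra p) Y.X 𝔭)] at hFT
  exact WithTop.add_left_cancel hfin hFT

/-- Corollary (the inequality the crux K′ displays): `ℓ_𝔭(𝐇¹ ⧸ C.Z) ≤ ℓ_𝔭 Y′.X` at every height-one `𝔭`.
[cite: Sprung2012, Prop. 7.19 and Main Conj. 7.21 (p. 1505)] [cite: Kato2004Asterisque, Conj. 12.10 (p. 224)] -/
theorem katoFineLengthAt_le_of_charIdeal_eq_contra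
    (C : SharpFlatColemanKatoDataContra W p f ϖ κ γ ι ap g c col I)
    (hirr : W.HasIrreducibleModPGaloisRep p) {Lsharp Lflat : IwasawaAlgebra p}
    (hSP : IsSprungPair f p ap Lsharp Lflat) (hcol : chromaticL col Lsharp Lflat ≠ 0)
    (D : SharpFlatSelmerDualData W κ γ⁻¹ ι ap g c col) [Module.Finite (IwasawaAlgebra p) D.X]
    (hDt : Module.IsTorsion (IwasawaAlgebra p) D.X) {gen : IwasawaAlgebra p}
    (hchar : D.charIdeal = Ideal.span {gen})
    (hgen : iwasawaToPowerSeries p gen =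
      PowerSeries.C ((ϖ : ℚ) : ℚ_[p]) * iwasawaToPowerSeries p (chromaticL col Lsharp Lflat))
    (Y : W.FineSelmerDualData κ γ⁻¹) (𝔭 : PrimeSpectrum (IwasawaAlgebra p)) (h𝔭 : 𝔭.asIdeal.height = 1) :
    Module.lengthAt (IwasawaAlgebra p) (I.H ⧸ C.Z) 𝔭 ≤ Module.lengthAt (IwasawaAlgebra p) Y.X 𝔭 :=
  (katoFineLengthAt_eq_of_charIdeal_eq_contra W p C hirr hSP hcol D hDt hchar hgen Y 𝔭 h𝔭).le

end Package

/-! ### §2 Main Conj. 7.21 (print key) for one datum ⟹ the cyclotomic lower bound C′ displays, at every prime -/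

/-- **Pure `Λ`-algebra behind C′**: if `char D′.X = (gen)` with `ι gen = C(ϖ)·ι L^•` and `G` is ANY Néron-normalised
generator (`ι G = C(ϖ)·ι L^•`), then `gen = G` (`ι` is injective) and `ℓ_𝔭 Λ/(G) ≤ ℓ_𝔭 D′.X` (indeed `=`) at every
height-one `𝔭`. [cite: Sprung2012, Main Conj. 7.21 (p. 1505)] [cite: SkinnerUrban2014, §3.1.6 (p. 20)] -/
theorem lengthAt_quotient_span_le_of_charIdeal_eq_contra {p : ℕ} [Fact p.Prime] {M : Type*} [AddCommGroup M]
    [Module (IwasawaAlgebra p) M] [Module.Finite (IwasawaAlgebra p) M]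
    (hM : Module.IsTorsion (IwasawaAlgebra p) M) {gen G : IwasawaAlgebra p} {w : ℚ_[p]}
    {L : IwasawaAlgebra p} (hchar : Module.charIdeal (IwasawaAlgebra p) M = Ideal.span {gen})
    (hgen : iwasawaToPowerSeries p gen = PowerSeries.C w * iwasawaToPowerSeries p L)
    (hG : iwasawaToPowerSeries p G = PowerSeries.C w * iwasawaToPowerSeries p L)
    (𝔭 : PrimeSpectrum (IwasawaAlgebra p)) (h𝔭 : 𝔭.asIdeal.height = 1) :
    Module.lengthAt (IwasawaAlgebra p) (IwasawaAlgebra p ⧸ Ideal.span {G}) 𝔭 ≤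
      Module.lengthAt (IwasawaAlgebra p) M 𝔭 := by
  have hGgen : G = gen := iwasawaToPowerSeries_injective p (hG.trans hgen.symm)
  rw [hGgen, ← lengthAt_eq_quotient_span_of_charIdeal_eq hM hchar 𝔭 h𝔭]

/-! ### §3 The route decls K′ (23732) and C′ (23733) BY NAME from Main Conj. 7.21 in print keying on X8 -/

/-- **K′ FROM THE PRINTED CONJECTURE.** Hypothesis `hMC` = Sprung 2012 Main Conj. 7.21 in PRINT keying on class X8,
ALL analytic ranks: VERBATIM the body of the route decl `PrintX8VSC.SharpFlatMainConjectureX8Contra` (item 23742) with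
its binder `W.analyticRank ≤ 1 →` deleted (= `Theorems.SprungSharpFlatMainConjecture W p •` with the dual datum
keyed `γ⁻¹`, Sprung's `𝒳^•*`). Conclusion: the crux decl `PrintX8VSC.KatoFineLowerSporadicGivenHeldX8Contra`
(item 23732) — whose four fact antecedents and sporadic / common-zero side conditions are not even needed beyond
Sprung Thm 7.14 (finiteness of the print-keyed dual, through the keying dictionary): on X8 some colour `•` has
`L^• ≠ 0` (Rohrlich), a `γ⁻¹`-keyed datum of that colour exists, `hMC` gives its characteristic ideal, and §1 at the
package of that colour (`Cs.Z = Cf.Z`) gives Kato's fine EQUALITY at `𝔭`. OPEN conjecture as hypothesis; K′ is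
NOT proved. [cite: Sprung2012, Thm. 7.14 (3) (p. 1504), Prop. 7.19 and Main Conj. 7.21 (p. 1505)]
[cite: Kato2004Asterisque, Conj. 12.10 (p. 224)] [cite: BurungaleSkinnerTianWan2024, (1.7) and Thm. 10.1] -/
theorem katoFineLowerSporadicGivenHeldX8Contra_of_mainConjecture721Contra
    (hMC : ∀ (W : WeierstrassCurve ℚ) [W.IsElliptic] [W.IsGloballyMinimal] (p : ℕ) [Fact p.Prime],
      ClassX8 W p → ∀ (col : Chroma) (κ : ZpExtension ℚ p) (γ : Field.absoluteGaloisGroup ℚ),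
      κ.IsCyclotomic → κ.IsTopGenerator γ → IsCyclotomicVariable p γ →
      ∀ (v : HeightOneSpectrum (𝓞 ℚ)), (p : 𝓞 ℚ) ∈ v.asIdeal →
      ∀ (g : Field.absoluteGaloisGroup (v.adicCompletion ℚ)),
        κ.IsTopGenerator (resGalOfEmb (closureEmb (K := ℚ) (v.adicCompletion ℚ)) g) →
      ∀ (cneg : localPoints W (v.adicCompletion ℚ)) (c : ℕ → localPoints W (v.adicCompletion ℚ)),
        IsHondaSystem κ (closureEmb (K := ℚ) (v.adicCompletion ℚ)) W (W.frobeniusTrace p) g cneg c →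
      ∀ (N : ℕ) (_ : NeZero N) (f : CuspForm (Gamma0 N) 2) (ϖ : ℚ) (Lsharp Lflat : IwasawaAlgebra p),
        IsNewformOf W f → (ϖ : ℝ) * W.realPeriodRat = plusPeriod f →
        IsSprungPair f p (W.frobeniusTrace p) Lsharp Lflat → chromaticL col Lsharp Lflat ≠ 0 →
      ∀ (D : SharpFlatSelmerDualData W κ γ⁻¹ (closureEmb (K := ℚ) (v.adicCompletion ℚ))
          (W.frobeniusTrace p) g c col),
        Module.IsTorsion (IwasawaAlgebra p) D.X ∧
        ∃ gen : IwasawaAlgebra p, D.charIdeal = Ideal.span {gen} ∧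
          iwasawaToPowerSeries p gen =
            PowerSeries.C (ϖ : ℚ_[p]) * iwasawaToPowerSeries p (chromaticL col Lsharp Lflat)) :
    Summit.BirchSwinnertonDyer.BirchSwinnertonDyer.Theses.PrintX8VSC.KatoFineLowerSporadicGivenHeldX8Contra := by
  intro h714 _h716c _h3 _hF W _ _ p _ _ _ _ hX κ γ hκ hγ hcv v hv g hg cneg c hH N hN f ϖ Lsharp Lflat hf hϖ hSP I Cs Cf
    hZ Y 𝔭 h𝔭 _hp𝔭 _hspor _hcommon
  haveI : NeZero N := hN
  obtain ⟨hp3, ⟨hgood, hap⟩, -⟩ := id hX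
  subst hp3
  have hirr : W.HasIrreducibleModPGaloisRep 3 := ClassX8.irr' W 3 hX
  obtain ⟨col₀, hcol₀⟩ := Rank1Residual.Supersingular.ClassX8.exists_chromaticL_ne_zero W 3 hX hf hSP
  -- a γ⁻¹-keyed (print) dual datum of the non-zero colour, finitely generated by Thm 7.14 through the dictionary
  obtain ⟨D'⟩ := nonempty_sharpFlatSelmerDualData_rat W κ γ⁻¹ v g c col₀
  obtain ⟨D₀⟩ := nonempty_sharpFlatSelmerDualData_rat W κ γ v g c col₀
  obtain ⟨hfin₀, -⟩ :=
    h714 W 3 (by decide) hgood hap f hf κ γ hκ hγ hcv v hv g hg cneg c hH col₀ Lsharp Lflat hSP hcol₀ D₀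
  haveI := hfin₀
  haveI : Module.Finite (IwasawaAlgebra 3) D'.X := (sharpFlatSelmerDualData_finite_inv_iff D₀ D').1 hfin₀
  -- Main Conj. 7.21 (print key) for that datum
  obtain ⟨hDt, gen, hchar, hgen⟩ :=
    hMC W 3 hX col₀ κ γ hκ hγ hcv v hv g hg cneg c hH N hN f ϖ Lsharp Lflat hf hϖ hSP hcol₀ D'
  -- §1 at the package of colour `col₀`
  cases col₀ with
  | sharp =>
    exact katoFineLengthAt_le_of_charIdeal_eq_contra W 3 Cs hirr hSP hcol₀ D' hDt hchar hgen Y 𝔭 h𝔭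
  | flat =>
    rw [hZ]
    exact katoFineLengthAt_le_of_charIdeal_eq_contra W 3 Cf hirr hSP hcol₀ D' hDt hchar hgen Y 𝔭 h𝔭

/-- **C′ FROM THE PRINTED CONJECTURE.** Same hypothesis `hMC` (Main Conj. 7.21 in print keying on X8, all ranks, every
colour with `L^• ≠ 0`); conclusion: the crux decl `PrintX8VSC.CyclotomicLowerPosLevelGivenHeldX8Contra` (item 23733) —
at EVERY height-one `𝔭` indeed, the cyclotomic / common-zero side conditions and the four fact antecedents unused:
`hMC` at the crux's own datum `D` gives `char D.X = (gen)`, `gen = G` by injectivity of `ι`, and §2. OPEN conjecture as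
hypothesis; C′ is NOT proved. [cite: Sprung2012, Prop. 7.19 and Main Conj. 7.21 (p. 1505)]
[cite: BurungaleSkinnerTianWan2024, (1.7) and Thm. 10.1] [cite: Sprung2024, Thm. 1.1 and Conj. 3.33] -/
theorem cyclotomicLowerPosLevelGivenHeldX8Contra_of_mainConjecture721Contra
    (hMC : ∀ (W : WeierstrassCurve ℚ) [W.IsElliptic] [W.IsGloballyMinimal] (p : ℕ) [Fact p.Prime],
      ClassX8 W p → ∀ (col : Chroma) (κ : ZpExtension ℚ p) (γ : Field.absoluteGaloisGroup ℚ),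
      κ.IsCyclotomic → κ.IsTopGenerator γ → IsCyclotomicVariable p γ →
      ∀ (v : HeightOneSpectrum (𝓞 ℚ)), (p : 𝓞 ℚ) ∈ v.asIdeal →
      ∀ (g : Field.absoluteGaloisGroup (v.adicCompletion ℚ)),
        κ.IsTopGenerator (resGalOfEmb (closureEmb (K := ℚ) (v.adicCompletion ℚ)) g) →
      ∀ (cneg : localPoints W (v.adicCompletion ℚ)) (c : ℕ → localPoints W (v.adicCompletion ℚ)),
        IsHondaSystem κ (closureEmb (K := ℚ) (v.adicCompletion ℚ)) W (W.frobeniusTrace p) g cneg c →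
      ∀ (N : ℕ) (_ : NeZero N) (f : CuspForm (Gamma0 N) 2) (ϖ : ℚ) (Lsharp Lflat : IwasawaAlgebra p),
        IsNewformOf W f → (ϖ : ℝ) * W.realPeriodRat = plusPeriod f →
        IsSprungPair f p (W.frobeniusTrace p) Lsharp Lflat → chromaticL col Lsharp Lflat ≠ 0 →
      ∀ (D : SharpFlatSelmerDualData W κ γ⁻¹ (closureEmb (K := ℚ) (v.adicCompletion ℚ))
          (W.frobeniusTrace p) g c col),
        Module.IsTorsion (IwasawaAlgebra p) D.X ∧
        ∃ gen : IwasawaAlgebra p, D.charIdeal = Ideal.span {gen} ∧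
          iwasawaToPowerSeries p gen =
            PowerSeries.C (ϖ : ℚ_[p]) * iwasawaToPowerSeries p (chromaticL col Lsharp Lflat)) :
    Summit.BirchSwinnertonDyer.BirchSwinnertonDyer.Theses.PrintX8VSC.CyclotomicLowerPosLevelGivenHeldX8Contra := by
  intro _h714 _h716c _h3 _hF W _ _ p _ _ _ _ hX col κ γ hκ hγ hcv v hv g hg cneg c hH N hN f ϖ Lsharp Lflat hf hϖ hSP hcol
    D hDfin hDt G hG _I _Cs _Cf _hZ 𝔭 h𝔭 _hT _hcyc _hcommon
  haveI := hDfin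
  obtain ⟨-, gen, hchar, hgen⟩ :=
    hMC W p hX col κ γ hκ hγ hcv v hv g hg cneg c hH N hN f ϖ Lsharp Lflat hf hϖ hSP hcol D
  exact lengthAt_quotient_span_le_of_charIdeal_eq_contra hDt hchar hgen hG 𝔭 h𝔭

/-! ### §4 From the route's own item 23742 (`SharpFlatMainConjectureX8Contra`, analytic rank ≤ 1): Kato's Conj. 12.10
in length form and the C′ inequality on X8 ∩ {r_an ≤ 1} — the locus of ALL 217 census cells (r0 142 + r1 75, ty3
`x8_records.json`, ref R-294 recount) -/

/-- **Item 23742 ⟹ Kato's Conj. 12.10 (print key, length form) on X8 ∩ {r_an ≤ 1}.** From the route decl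
`PrintX8VSC.SharpFlatMainConjectureX8Contra` BY NAME (as filed: analytic rank ≤ 1) and Sprung Thm 7.14 (`h714`, finiteness
of the print-keyed dual through the keying dictionary): for every X8 pair of analytic rank ≤ 1, cyclotomic data, Honda
system, newform/period/Sprung pair, every colour `•` with `L^• ≠ 0`, every pinned `𝐇¹`-datum `I`, every contragredient
package `C` of colour `•` over `I`, every print-keyed fine datum `Y′` and every height-one `𝔭`:
`ℓ_𝔭(𝐇¹ ⧸ C.Z) = ℓ_𝔭 Y′.X`. With the PROVED glue 23743 (K′ ∧ C′ ∧ packs ⟹ 23742) this closes the circle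
«cruxes ⟹ MC′ ⟹ crux conclusions» on the rank ≤ 1 locus. OPEN item as hypothesis; nothing asserted.
[cite: Sprung2012, Thm. 7.14 (3) (p. 1504), Prop. 7.19 and Main Conj. 7.21 (p. 1505)] [cite: Kato2004Asterisque, Conj. 12.10 (p. 224)] -/
theorem katoFineLengthAt_eq_rankLeOne_of_sharpFlatMainConjectureX8Contra
    (hMC : Summit.BirchSwinnertonDyer.BirchSwinnertonDyer.Theses.PrintX8VSC.SharpFlatMainConjectureX8Contra)
    (h714 : thm714_sharpFlatSelmerDual_finite_torsion) :
    ∀ (W : WeierstrassCurve ℚ) [W.IsElliptic] [W.IsGloballyMinimal] (p : ℕ) [Fact p.Prime]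
      [ContinuousSMul ℤ_[p] (W.tateModule p)] [Module.Free ℤ_[p] (W.tateModule p)]
      [Module.Finite ℤ_[p] (W.tateModule p)],
      ClassX8 W p → W.analyticRank ≤ 1 → ∀ (κ : ZpExtension ℚ p) (γ : Field.absoluteGaloisGroup ℚ),
      κ.IsCyclotomic → κ.IsTopGenerator γ → IsCyclotomicVariable p γ →
    ∀ (v : HeightOneSpectrum (𝓞 ℚ)), (p : 𝓞 ℚ) ∈ v.asIdeal →
    ∀ (g : Field.absoluteGaloisGroup (v.adicCompletion ℚ)),
      κ.IsTopGenerator (resGalOfEmb (closureEmb (K := ℚ) (v.adicCompletion ℚ)) g) →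
    ∀ (cneg : localPoints W (v.adicCompletion ℚ)) (c : ℕ → localPoints W (v.adicCompletion ℚ)),
      IsHondaSystem κ (closureEmb (K := ℚ) (v.adicCompletion ℚ)) W (W.frobeniusTrace p) g cneg c →
    ∀ (N : ℕ) (_ : NeZero N) (f : CuspForm (Gamma0 N) 2) (ϖ : ℚ) (Lsharp Lflat : IwasawaAlgebra p),
      IsNewformOf W f → (ϖ : ℝ) * W.realPeriodRat = plusPeriod f →
      IsSprungPair f p (W.frobeniusTrace p) Lsharp Lflat →
    ∀ (col : Chroma), chromaticL col Lsharp Lflat ≠ 0 →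
    ∀ (I : IwasawaH1Data W p κ γ)
      (C : SharpFlatColemanKatoDataContra W p f ϖ κ γ (closureEmb (K := ℚ) (v.adicCompletion ℚ))
        (W.frobeniusTrace p) g c col I)
      (Y : W.FineSelmerDualData κ γ⁻¹) (𝔭 : PrimeSpectrum (IwasawaAlgebra p)), 𝔭.asIdeal.height = 1 →
      Module.lengthAt (IwasawaAlgebra p) (I.H ⧸ C.Z) 𝔭 = Module.lengthAt (IwasawaAlgebra p) Y.X 𝔭 := by
  intro W _ _ p _ _ _ _ hX hr κ γ hκ hγ hcv v hv g hg cneg c hH N hN f ϖ Lsharp Lflat hf hϖ hSP col hcol I C Y 𝔭 h𝔭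
  haveI : NeZero N := hN
  obtain ⟨hp3, ⟨hgood, hap⟩, -⟩ := id hX
  subst hp3
  have hirr : W.HasIrreducibleModPGaloisRep 3 := ClassX8.irr' W 3 hX
  obtain ⟨D'⟩ := nonempty_sharpFlatSelmerDualData_rat W κ γ⁻¹ v g c col
  obtain ⟨D₀⟩ := nonempty_sharpFlatSelmerDualData_rat W κ γ v g c col
  obtain ⟨hfin₀, -⟩ :=
    h714 W 3 (by decide) hgood hap f hf κ γ hκ hγ hcv v hv g hg cneg c hH col Lsharp Lflat hSP hcol D₀
  haveI := hfin₀
  haveI : Module.Finite (IwasawaAlgebra 3) D'.X := (sharpFlatSelmerDualData_finite_inv_iff D₀ D').1 hfin₀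
  obtain ⟨hDt, gen, hchar, hgen⟩ :=
    hMC W 3 hX hr col κ γ hκ hγ hcv v hv g hg cneg c hH N hN f ϖ Lsharp Lflat hf hϖ hSP hcol D'
  exact katoFineLengthAt_eq_of_charIdeal_eq_contra W 3 C hirr hSP hcol D' hDt hchar hgen Y 𝔭 h𝔭

/-- **Item 23742 ⟹ the C′ inequality on X8 ∩ {r_an ≤ 1}, at EVERY height-one prime** (not only the positive-level
cyclotomic ones): for every print-keyed dual datum `D` of a colour with `L^• ≠ 0` (f.g.) and every Néron-normalised `G`,
`ℓ_𝔭 Λ/(G) ≤ ℓ_𝔭 D.X`. From the route decl BY NAME and §2. OPEN item as hypothesis; nothing asserted.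
[cite: Sprung2012, Prop. 7.19 and Main Conj. 7.21 (p. 1505)] -/
theorem lengthAt_quotient_span_le_rankLeOne_of_sharpFlatMainConjectureX8Contra
    (hMC : Summit.BirchSwinnertonDyer.BirchSwinnertonDyer.Theses.PrintX8VSC.SharpFlatMainConjectureX8Contra) :
    ∀ (W : WeierstrassCurve ℚ) [W.IsElliptic] [W.IsGloballyMinimal] (p : ℕ) [Fact p.Prime],
      ClassX8 W p → W.analyticRank ≤ 1 → ∀ (col : Chroma) (κ : ZpExtension ℚ p) (γ : Field.absoluteGaloisGroup ℚ),
      κ.IsCyclotomic → κ.IsTopGenerator γ → IsCyclotomicVariable p γ →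
    ∀ (v : HeightOneSpectrum (𝓞 ℚ)), (p : 𝓞 ℚ) ∈ v.asIdeal →
    ∀ (g : Field.absoluteGaloisGroup (v.adicCompletion ℚ)),
      κ.IsTopGenerator (resGalOfEmb (closureEmb (K := ℚ) (v.adicCompletion ℚ)) g) →
    ∀ (cneg : localPoints W (v.adicCompletion ℚ)) (c : ℕ → localPoints W (v.adicCompletion ℚ)),
      IsHondaSystem κ (closureEmb (K := ℚ) (v.adicCompletion ℚ)) W (W.frobeniusTrace p) g cneg c →
    ∀ (N : ℕ) (_ : NeZero N) (f : CuspForm (Gamma0 N) 2) (ϖ : ℚ) (Lsharp Lflat : IwasawaAlgebra p),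
      IsNewformOf W f → (ϖ : ℝ) * W.realPeriodRat = plusPeriod f →
      IsSprungPair f p (W.frobeniusTrace p) Lsharp Lflat → chromaticL col Lsharp Lflat ≠ 0 →
    ∀ (D : SharpFlatSelmerDualData W κ γ⁻¹ (closureEmb (K := ℚ) (v.adicCompletion ℚ))
        (W.frobeniusTrace p) g c col) [Module.Finite (IwasawaAlgebra p) D.X] (G : IwasawaAlgebra p),
      iwasawaToPowerSeries p G = PowerSeries.C (ϖ : ℚ_[p]) * iwasawaToPowerSeries p (chromaticL col Lsharp Lflat) →
    ∀ (𝔭 : PrimeSpectrum (IwasawaAlgebra p)), 𝔭.asIdeal.height = 1 →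
      Module.lengthAt (IwasawaAlgebra p) (IwasawaAlgebra p ⧸ Ideal.span {G}) 𝔭 ≤
        Module.lengthAt (IwasawaAlgebra p) D.X 𝔭 := by
  intro W _ _ p _ hX hr col κ γ hκ hγ hcv v hv g hg cneg c hH N hN f ϖ Lsharp Lflat hf hϖ hSP hcol D hDfin G hG 𝔭 h𝔭
  haveI := hDfin
  obtain ⟨hDt, gen, hchar, hgen⟩ :=
    hMC W p hX hr col κ γ hκ hγ hcv v hv g hg cneg c hH N hN f ϖ Lsharp Lflat hf hϖ hSP hcol D
  exact lengthAt_quotient_span_le_of_charIdeal_eq_contra hDt hchar hgen hG 𝔭 h𝔭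

end Summit.BirchSwinnertonDyer.BirchSwinnertonDyer.Theorems.PrintX8VSCOfMainConjecture721

end
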